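import Summits.FinalStateConjecture.FinalStateConjecture.Theses.PhaseMixingCapture
import Summits.FinalStateConjecture.FinalStateConjecture.Theorems.NearExtremalKappaCapture.Negative.ExponentMonotonicity
import Summits.FinalStateConjecture.FinalStateConjecture.Theorems.NearExtremalKappaCapture.Negative.SubextremalRedundancy
import Literature.Geometry.Lorentzian.KerrRedShiftBulk
import Literature.Geometry.Lorentzian.KerrStarCoord
import Literature.Geometry.Lorentzian.KerrConvergence

/-!
# Line `unit-temperature-front-face` for crux `PhaseMixingCapture.NearExtremalKappaCapture`
# (stmt-FinalStateConjecture-10606) — skeleton, rev 2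

Crux-plan skeleton, rev 2 (`planner-cruxplan-stmt-FinalStateConjecture-10606-unit-temperature-fro-g2-0`,
2026-08-16; supersedes rev 1 of seat `…-unit-temperature-fro-0`, same path). Route
`route-FinalStateConjecture-PhaseMixingCapture` (rank-2 crux, `hardest`); idea card
`Cruxes/NearExtremalKappaCapture/Ideas/unit-temperature-front-face.md` (ideator 1, round 1; triage r1-1/2/3:
pass ×3, merge ⊇ `temperature-is-gauge-in-the-throat`); line card `Lines/unit-temperature-front-face.md`.
POSITIVE line: `NearExtremalKappaCapture_of` concludes the crux decl BY NAME from the four registered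
stub statements and the route's linear floor `KappaExplicitWaveDecay` (route item stmt-FinalStateConjecture-10654,
admissible by name).

REV 2 CHANGES (all statements re-checked on the farm, rc 0, sorries only in `stub_*`):
* S1 now records the WHOLE front face: the `σ → 0` limit of the blown-up frame components is written
  out and it is near-NHEK at unit temperature in ingoing co-rotating form,
  `ds² = M²(1+c²)[−4x̂(1+x̂)dt̂² + 4dt̂dx̂ + dθ²] + (4M²(1−c²)/(1+c²))(dφ̂ + 2x̂dt̂)²`, `c = cos θ`
  (verified against the tree's Kerr–Schild conventions to 60 digits, all ten components, `kit/s1_face_metric_check.py`: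
  `|G_{αβ}(σ) − N_{αβ}| = O(σ)` on `x̂ ∈ [−½, 3]`, all `θ`); consequence used downstream: the face
  generator `∂_t̂` is timelike exactly on `0 < x̂ < x_L(θ)`, `x_L ≥ 1/3` with equality on the equator
  (triage r1-2 R3 / r1-3 P2, now a clause of a registered statement instead of prose).
* The sub-extremality conjunct is restored through the LANDED `Negative.SubextremalRedundancy`
  (`near_iff_withoutSub`, p74448; built on the farm now) — the 90-line inlined copy of rev 1 is gone and
  S4 concludes `CaptureWithoutSub s δ k γ p a₁` BY NAME.
* Disproof v3 (§5 germ localisation, §6 lighter members, §7 bare form) read and cited below.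

## The crux (recall; `Negative.near_iff`, `near_iff_diagonal`, `near_iff_withoutSub`, Disproof §5 `near_iff_germ`)

`NearExtremalKappaCapture ↔ ∀ [Kerr.Facts] [Kerr.SliceFacts], ∃ (s δ k γ p a₁), a₁ < 1 ∧ CaptureWith s δ k γ p a₁`:
on the near-extremal range `a₁M ≤ |a| < M`, vacuum data on the horizon-penetrating Kerr–Schild slice
`Kerr.slice a M = {t* = 0, r > M}` within `H^s_δ`-distance `c·χ^γ` (`χ = 1 − (a/M)²`, `κM ∈ [√χ/4, √χ/2]`) of
`Kerr.data M a M` have all their MGHDs far-complete, `Cᵏ`-converging to a Kerr exterior `g_{M',a'}`, with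
modulus `|M'−M| + |a'−a| ≤ C·χ^{−p}·√dist`. Content = the RATE at the extremal germ (Disproof §5): basin and
modulus degenerate at most POLYNOMIALLY in `κ`; one integer exponent suffices (`near_iff_diagonal`); the
conjunct `IsSubextremal M' a'` is free (`near_iff_withoutSub`).

## The line (lever: the unit-temperature front face)

Blow the degenerating family `{Kerr(M, a)}_{|a|→M}` up at its event horizon in the co-rotating, thermally
rescaled coordinates `t̂ = κ t*`, `x̂ = (r − r₊)/(r₊ − r₋)`, `φ̂ = φ* − ω₊ t*` (angle `θ` fixed, NO conformal
factor). The frame `ê = (κ⁻¹K, (r₊−r₋)∂_r, ∂_θ, ∂_φ*)` (`K = T + ω₊Φ` = `Kerr.hawkingVector`) IS the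
coordinate frame of `(t̂, x̂, θ, φ̂)`, and in it the Kerr–Schild components converge, as `σ = √χ → 0` at
fixed `(x̂, θ)` and jointly `C^∞` down to `σ = 0`, to near-NHEK at UNIT temperature in ingoing form
(`stub_unitTemperatureFace`, the explicit metric above): a smooth non-degenerate Ricci-flat face whose
horizon `x̂ = 0` is a NON-degenerate Killing horizon of `∂_t̂` with surface gravity exactly `1`, on which the
slice `{t* = 0, r > M}` is the FIXED domain `x̂ > −½`. The two structures whose failure at `|a| = M` stops
the printed full-range proof (Hintz arXiv:2606.28253 Rem. 1.4: (a) normally hyperbolic trapping, (b) the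
non-degenerate radial source at `N*𝓗⁺` = Dafermos–Rodnianski red-shift) degenerate at ONE rate `κ` in ONE
place and are `O(1)` on the face; blown down, face estimates are estimates with constants that are
EXPLICIT POWERS of `κ` — what the crux permits and `AretakisInstabilityNarrow` forbids to improve. (b) made
quantitative is `stub_faceRedShift` (red-shift bulk coercive on the face collar `|x̂| ≤ θ₀`, coercivity
`bκ^{N₁}`, multipliers `≤ Aκ^{−N₁}`, uniformly on `|a| < M`; expected `N₁ = 1`); (a) is the route's linear
floor `KappaExplicitWaveDecay` (sibling line `extremal-corner-blowup`: the same blow-up on the radial ODE).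
The line's own NONLINEAR bet (card point (4)) is `stub_thermalTimeStability`: anchored Cauchy stability
of the MGHD on `{0 < t* ≤ T/κ, r > M}` with loss `χ^{−N}`, not `e^{C/κ}` ("symmetry broken at rate `κ`
acting for time `κ⁻¹` costs `e^{O(1)}`"). The transfer `stub_captureTransfer` (HARDEST) runs the nonlinear
scheme on the resolved space — collar `x̂ ≤ X < 1/3` (inside the face light surface, by S1's face clause)
in thermal time with `κ`-free constants as an a-priori estimate COUPLED to the far solution (never a
stand-alone IBVP), far face `r − M ≳ cM` a-uniform, throat via the linear floor, ONE face modulation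
parameter (temperature ratio `κ'/κ`, drift `≍ dist/χ`: kinematic basin law `γ = 1 +` matching loss) — and
concludes the crux body without the sub-extremality conjunct.

    NearExtremalKappaCapture  ⇐[near_iff_withoutSub]  ∀[..] ∃ s δ k γ p a₁, a₁ < 1 ∧ CaptureWithoutSub s δ k γ p a₁
      = stub_captureTransfer (THERMAL) (KappaExplicitWaveDecay)
      THERMAL = stub_thermalTimeStability (stub_unitTemperatureFace) (stub_faceRedShift)

All four stubs are stated over IMPORTABLE vocabulary only (Literature `Kerr.*`, `KerrSchild.multiplierBulk`,
`ModelBackground` / `Spacetime.deviationCk`, `VacuumCauchyDevelopment`; the Theses decl `KappaExplicitWaveDecay`;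
the landed Theorems-side `Negative.FarComplete` / `Negative.CaptureWithoutSub`), so each can be landed under
`Theorems/` with its registered signature (all four < 3900 chars; NO `let … :=` inside a stub statement —
the registry's signature extraction stops at the first `:=`, which truncated rev 1's registrations — so the
blown-up point/frame of S1 are universally quantified abbreviations `∀ a r pt e, a = … → … →` and S3/S4 write
the background `⟨Kerr.region a M, Kerr.bilin M a, t*, r⟩` and the thermal time `T/κ` in place).
`Statement.stub_…` below are NAMES (`type_of%`) for the four statements, so that the hypotheses of the
composition are admissible by name.

## Disproof used (`Cruxes/NearExtremalKappaCapture/Disproof.lean`, cdisprove v3 = cycle 2, read 2026-08-16T02:3xZ)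

Verdict there: no kill; NO `_false_without_<H>` theorem, so no "uses H at stub_k" line is owed. Honoured:
§0–§3 (`near_iff`, `captureWith_mono`, `near_iff_diagonal`, `captureWith_self`): every stub asserts `∃`
exponents only (one basin exponent, one loss exponent; `k` free), the centre `dist = 0` is the exact
anchored chart of S3 (deviation `0`) and S4's modulus pins `(M', a') = (M, a)`. §1/§7 (instances are
theorems, `near_iff_exists`): S3/S4 keep the crux's `∀ [Kerr.Facts] [Kerr.SliceFacts]` prefix — nothing
hides behind a binder. §4 amended (`near_iff_withoutSub`, LANDED p74448): USED — it is the entry of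
`NearExtremalKappaCapture_of`; the third-law fork `captureWith_false_of_extremalFormation` bites only
`γ < 2p + 2`, below the line's exponents. §5 (`captureWith_plainOn`, `near_iff_germ`): CONSISTENT — the
line works on the tail `σ ≤ ½` (`|a| ≥ (√3/2)M`) where the blow-up chart is good, which is all the crux
asks (`∃ a₁`); bulk spins are `BulkKerrCapture`'s. §6 (`captureWith_false_of_lighterMembers`: any proof
takes `γ ≥ 1` or `δ ≥ −1/2`): CONSISTENT — `γ`, `δ` existential in S3/S4; the kinematic basin law of the
line is `γ = 1 +` matching loss, and the exterior-truncated lighter member `Kerr(M−η, a)`, `η > Mχ/2`,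
is exactly the datum whose face size `η/χ` is `O(1)`: it leaves the unit-temperature chart, as the card
predicted. Landed Negative lemmas each stub is checked against: `ExponentMonotonicity`, `SubextremalRedundancy`
(both imported; no stub is an instance of a refuted statement; `ledger negatives`: one unrelated entry,
`¬UniformPhotonSphereChannels`). Refuter paper notes honoured: `IsSubextremal M a` guard in every stub
(`κ > 0`: no blow-down at `κ = 0`), ATTACK-10606 (`γ ≥ 1`), r1-2 R2 (`δ ≥ 1/2`), r1-3 P4 (`δ ≥ −s`) — all
consistent with the `∃ (s, δ, γ)` outputs; reflection `a ↦ −a` used positively (S1 stated for `a ≥ 0`).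
-/

set_option linter.unusedVariables false
set_option linter.unusedTactic false
set_option linter.unreachableTactic false
set_option linter.dupNamespace false

namespace Summit.FinalStateConjecture.FinalStateConjecture.Cruxes.NearExtremalKappaCapture.UnitTemperatureFrontFace

open Summit.FinalStateConjecture.FinalStateConjecture.Theses.PhaseMixingCapture
open Summit.FinalStateConjecture.FinalStateConjecture.Theorems.NearExtremalKappaCapture.Negative
open Literature.Geometry.Lorentzian
open Set Filter
open scoped Topology Manifold ENNReal ContDiff

/-! ## The four registered stubs -/

/-- **S1 · `stub_unitTemperatureFace` — the resolved family exists, every face has a unit-temperature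
horizon, and the front face IS near-NHEK₁ in ingoing form.** For `M > 0` and a face depth `X > 0` there
is a family of component matrices `G σ x̂ θ : Fin 4 → Fin 4 → ℝ`, JOINTLY `C^∞` in
`(σ, x̂, θ) ∈ [0, ½] × [−½, X] × ℝ` — up to and including the extremal endpoint `σ = 0` — such that:
(i) for `0 < σ ≤ ½`, with `a = M√(1 − σ²)` (so `σ = √χ`, `r± = M(1 ± σ)`, `κ = σ/(2M(1+σ))`; `a, r, pt, e` enter as
universally quantified abbreviations pinned by equations, `rintro … rfl rfl rfl rfl`),
`G σ x̂ θ α β = g_{M,a}(ê_α, ê_β)` at the Kerr–Schild point `pt = (0, Kerr.kerrStar a r θ φ)`, `r = r₊ + x̂(r₊ − r₋)`,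
in the BLOWN-UP co-rotating Kerr-star frame `ê₀ = κ⁻¹K` (`K = Kerr.hawkingVector`), `ê₁ = (r₊ − r₋)∂_r`
(`∂_r` at fixed `t_KS, θ, φ*`: `sphRadial`), `ê₂ = ∂_θ`, `ê₃ = ∂_φ* = Kerr.axialVector` — the coordinate
frame of `(t̂, x̂, θ, φ̂) = (κt*, (r−r₊)/(r₊−r₋), θ, φ* − ω₊t*)`, independent of `φ` by axisymmetry;
(ii) on EVERY face `σ ∈ [0, ½]` the horizon `x̂ = 0` of `∂_t̂ = ê₀` has unit surface gravity:
`G₀₀ = 0`, `G₀₁ = 2Σ₊ = 2(r₊² + a²cos²θ)`, `∂_x̂G₀₀ = −2G₀₁` at `x̂ = 0` (for `σ > 0`: `K` null on `𝓗⁺`,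
`g(K, ∂_r)|₊ = Σ₊/(r₊²+a²)`, `∇(K·K) = −2κK♭`, `(r₊−r₋)/κ = 2(r₊²+a²)`; at `σ = 0` by continuity);
(iii) the FRONT FACE `σ = 0` is near-NHEK at unit temperature in ingoing co-rotating coordinates:
`G₀₀ = −4M²(1+c²)x̂(1+x̂) + 16M²(1−c²)x̂²/(1+c²)`, `G₀₁ = 2M²(1+c²)`, `G₁₁ = 0`, `G₂₂ = M²(1+c²)`,
`G₃₃ = 4M²(1−c²)/(1+c²)`, `G₀₃ = 8M²(1−c²)x̂/(1+c²)`, `G₀₂ = G₁₂ = G₁₃ = G₂₃ = 0` (`c = cos θ`), i.e.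
`ds² = M²(1+c²)[−4x̂(1+x̂)dt̂² + 4dt̂dx̂ + dθ²] + (4M²(1−c²)/(1+c²))(dφ̂ + 2x̂dt̂)²` (Bardeen–Horowitz
hep-th/9905099; BHSS arXiv:0907.3477, near-NHEK). Consequences (not restated): `∂_t̂` is timelike on the face
exactly for `0 < x̂ < x_L(θ) = (1+c²)²/(4(1−c²) − (1+c²)²)₊` — all `x̂ > 0` when `c² ≥ 2√3 − 3`, only
`x̂ < 1/3` on the equator (the face light surface); the face is non-degenerate (`det = −G₀₁²G₂₂G₃₃ ≠ 0`).
WHY TRUE: every entry is analytic in `(σ, x̂, θ)` near `σ = 0` (`√(1−σ²)`, `r± = M(1±σ)`, `κ⁻¹ = 2M(1+σ)/σ`;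
`Kerr.bilin` analytic on `r ≥ M(1−2σ·½) = M > 0`); the `κ⁻¹` factors cancel exactly except in
`G₀₀ = κ⁻²g(K,K)` and `G₀₃ = κ⁻¹g(K,Φ)`, where `g(K,K)` resp. `g(K,Φ)` vanish to order `σ²` resp. `σ` on
`{σ = 0}` (at `σ = 0`, `r ≡ M` is the extremal horizon, where `K` is null and `⊥ Φ`); the limits were
CHECKED against the tree's Kerr–Schild conventions to 60 digits (rev 2, `kit/s1_face_metric_check.py`: all ten
components, `O(σ)` rate, `x̂ ∈ [−½, 3]`, seven polar angles; rev 1/triage r1-2 E3, r1-3 P2 for `G₀₀`).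
Size M–L (explicit real algebra with `√(1−σ²)` and the `kerrStar` calculus; the joint smoothness at
`σ = 0` needs the two explicit factorisations `g(K,K) = σ²·F̃`, `g(K,Φ) = σ·Φ̃`, cf. `Kerr.hawking_F_factor`).
Leans on: `Kerr.bilin_apply`, `Kerr.hawkingVector`, `Kerr.bilin_basisVector_add_smul_axialVector`,
`Kerr.hawking_rho_sq_mul_eq`, `Kerr.hawking_F_factor`, `Kerr.radius_kerrStar`, `Kerr.scalarH_kerrStar`,
`hasDerivAt_kerrStar_{r,theta,phi}`, `Kerr.surfaceGravity_eq_rPlus_sub_rMinus_div`, `Kerr.rPlus_sub_rMinus`,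
`Kerr.isNull_hawkingField`. Feeds: hypothesis of `stub_thermalTimeStability`; the face clause (iii) is what
makes "`κ`-free local theory on the face" and "collar cut at `X < 1/3`" statements about a named metric.
Negative spins: `Kerr(M, a) ≅ Kerr(M, −a)` by `x₂ ↦ −x₂`, so `a ≥ 0` is no loss. -/
theorem stub_unitTemperatureFace :
    (∀ M : ℝ, 0 < M → ∀ X : ℝ, 0 < X →
      ∃ G : ℝ → ℝ → ℝ → Fin 4 → Fin 4 → ℝ,
        ContDiffOn ℝ ∞ (fun q : ℝ × ℝ × ℝ ↦ G q.1 q.2.1 q.2.2)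
            (Icc (0 : ℝ) (1 / 2) ×ˢ Icc (-(1 / 2) : ℝ) X ×ˢ (univ : Set ℝ)) ∧
        (∀ σ ∈ Ioc (0 : ℝ) (1 / 2), ∀ x ∈ Icc (-(1 / 2) : ℝ) X, ∀ θ φ : ℝ, ∀ α β : Fin 4,
          ∀ (a r : ℝ) (pt : E4) (e : Fin 4 → E4), a = M * √(1 - σ ^ 2) →
            r = Kerr.rPlus M a + x * (Kerr.rPlus M a - Kerr.rMinus M a) →
            pt = E4.ofTimeSpace 0 (Kerr.kerrStar a r θ φ) →
            e = ![(Kerr.surfaceGravity M a)⁻¹ • Kerr.hawkingVector M a pt,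
                  (Kerr.rPlus M a - Kerr.rMinus M a) • E4.ofTimeSpace 0 (sphRadial θ φ),
                  E4.ofTimeSpace 0 (r • sphPolar θ φ + (a * Real.cos θ) • sphAzimuth φ),
                  Kerr.axialVector pt] →
            G σ x θ α β = Kerr.bilin M a pt (e α) (e β)) ∧
        (∀ σ ∈ Icc (0 : ℝ) (1 / 2), ∀ θ : ℝ,
          G σ 0 θ 0 0 = 0 ∧
          G σ 0 θ 0 1 = 2 * (Kerr.rPlus M (M * √(1 - σ ^ 2)) ^ 2 + (M * √(1 - σ ^ 2)) ^ 2 * Real.cos θ ^ 2) ∧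
          deriv (fun x : ℝ ↦ G σ x θ 0 0) 0 = -2 * G σ 0 θ 0 1) ∧
        (∀ x ∈ Icc (-(1 / 2) : ℝ) X, ∀ θ : ℝ,
          G 0 x θ 0 0 = -4 * M ^ 2 * (1 + Real.cos θ ^ 2) * x * (1 + x) +
              16 * M ^ 2 * (1 - Real.cos θ ^ 2) * x ^ 2 / (1 + Real.cos θ ^ 2) ∧
          G 0 x θ 0 1 = 2 * M ^ 2 * (1 + Real.cos θ ^ 2) ∧ G 0 x θ 1 1 = 0 ∧
          G 0 x θ 2 2 = M ^ 2 * (1 + Real.cos θ ^ 2) ∧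
          G 0 x θ 3 3 = 4 * M ^ 2 * (1 - Real.cos θ ^ 2) / (1 + Real.cos θ ^ 2) ∧
          G 0 x θ 0 3 = 8 * M ^ 2 * (1 - Real.cos θ ^ 2) * x / (1 + Real.cos θ ^ 2) ∧
          G 0 x θ 0 2 = 0 ∧ G 0 x θ 1 2 = 0 ∧ G 0 x θ 1 3 = 0 ∧ G 0 x θ 2 3 = 0)) := by
  sorry

/-- **S2 · `stub_faceRedShift` — the Dafermos–Rodnianski red-shift is non-degenerate ON THE FACE, i.e. holds
on the collar of blown-up width `θ₀` with constants that are explicit powers of `κ`, uniformly on `|a| < M`.**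
For `M > 0` there are `N₁`, `A`, `θ₀ > 0`, `b > 0` such that for every sub-extremal spin `a` there are
multiplier parameters `h₁, f₁` with `|h₁| + |f₁| ≤ A κ^{−N₁}` (`κ = Kerr.surfaceGravity M a`) for which the
bulk term `K^N = T_{μν}[w] ∇^μ N^ν` (`KerrSchild.multiplierBulk` for `g⁻¹ = Kerr.inverseMetric M a`) of the
red-shift vector field `N = (1 + h₁(r − r₊))K + (1 + f₁(r − r₊))k` (`Kerr.redShiftVector M a h₁ f₁`;
`K = Kerr.hawkingVector`, `k = −ℓ♯`) satisfies, at every point of the collar `|r − r₊| ≤ θ₀ (r₊ − r₋)`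
(face collar `|x̂| ≤ θ₀`; note `r ≥ M > 0` there) and for every `w` differentiable at the point,
`K^N ≥ b κ^{N₁} (λ² + v² + |q̸|²)`, `λ = dw(K)` (`Kerr.hawkingComp`), `v = dw(k)` (`Kerr.frameIn`),
`q̸ = (dw + v dr)` angular part (`Kerr.frameAngSq`) — the null-frame energy density, uniformly comparable to
`|dw|²`. WHY PLAUSIBLY TRUE (expected `N₁ = 1`): on `r = r₊` the tree's exact horizon form
`K^N = 2H h₁ λ² + ½ f₁ |q̸|² + 2Hκ v² − (4Hr₊/Σ) λ v + (2r₊/Σ) v (q̸·∇̸r)`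
(`Kerr.multiplierBulk_redShiftVector_of_radius_eq_rPlus`, `Kerr.redShiftCoeff_eq_surfaceGravity`) is
`≥ ½Hκ v² + (HA/κ)λ² + (A/4κ)|q̸|²` for `h₁ = f₁ = A/κ`, `A = A(M)` large (Cauchy–Schwarz on the two bounded
cross terms: `|λv| ≤ εκv² + λ²/(4εκ)`); off the horizon the exact formula `Kerr.multiplierBulk_redShiftVector`
changes by terms `O(Aθ₀)·(λ², λq̸, q̸², λv, q̸v)` (the `A/κ`-size `λv` pieces cancel exactly at `r₊` because
`∇r ∥ K` there — `raisedDotRadius_of_radius_eq_rPlus` — and reappear only with a factor `r − r₊ = O(θ₀κ)`)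
and by `O(Aθ₀κ + θ₀κ)·v²` (`−½ f₁ (Δ/Σ) v²`, `Kerr.raisedDotRadius_mul_frameIn_add`, and the Taylor
remainder of the `2Hκ`-term), all absorbable for `θ₀ ≲ A^{-1/2}·H`: this is DR arXiv:0811.0354 Thm. 7.1
("`K^N ≥ b J^N·N` near `𝓗⁺`, `b` from `κ > 0`") with the compactness step replaced by the blow-up — in `x̂`
the collar is fixed and every coefficient is `O(1)`, `κ` entering only through `v²`'s weight. WHY IT MIGHT
FAIL: only through a wrong power — e.g. if a cross term forced `h₁ ∝ κ^{−2}` the bound holds with `N₁ = 2`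
(hence `∃ N₁`). Size L (pointwise real algebra over the tree's exact identities + uniform `C¹` control of
the coefficients on the collar, e.g. via S1-type blown-up smoothness). Role: Hintz's structure (b) made
quantitative; the horizon-side input of the `κ`-free face energy estimate inside S3/S4. Provable NOW. -/
theorem stub_faceRedShift :
    (∀ M : ℝ, 0 < M → ∃ (N₁ : ℕ) (A θ₀ b : ℝ), 0 < θ₀ ∧ 0 < b ∧
      ∀ a : ℝ, Kerr.IsSubextremal M a → ∃ h₁ f₁ : ℝ,
        |h₁| + |f₁| ≤ A * (Kerr.surfaceGravity M a)⁻¹ ^ N₁ ∧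
        ∀ x : E4, |Kerr.radius a x - Kerr.rPlus M a| ≤ θ₀ * (Kerr.rPlus M a - Kerr.rMinus M a) →
          ∀ w : E4 → ℝ, DifferentiableAt ℝ w x →
            b * Kerr.surfaceGravity M a ^ N₁ *
                (Kerr.hawkingComp M a x (fun μ ↦ fderiv ℝ w x (E4.basisVector μ)) ^ 2 +
                  Kerr.frameIn a x (fun μ ↦ fderiv ℝ w x (E4.basisVector μ)) ^ 2 +
                  Kerr.frameAngSq a x ((fun μ ↦ fderiv ℝ w x (E4.basisVector μ)) +
                    Kerr.frameIn a x (fun μ ↦ fderiv ℝ w x (E4.basisVector μ)) • Kerr.dRadius a x)) ≤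
              KerrSchild.multiplierBulk (Kerr.inverseMetric M a) (Kerr.redShiftVector M a h₁ f₁) w x) := by
  sorry

/-- **S3 · `stub_thermalTimeStability` — "the transient is unit thermal time": ANCHORED Cauchy stability of the
MGHD up to Kerr–Schild time `T/κ` with POLYNOMIAL loss (the card's point (4); nonlinear, the line's own bet).**
Given the resolved family (statement of S1) and the face red-shift (statement of S2): for every thermal time
`T > 0` and every regularity `k` there are a Sobolev index `s`, a weight `δ`, a basin exponent `γ`, a loss
exponent `p` and a near-extremal threshold `a₁ < 1` such that for every `M > 0` there are `c > 0`, `C` with: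
for `a₁M ≤ |a| < M`, every vacuum datum `D` on `Kerr.slice a M` within `H^s_δ`-distance `c·χ^γ` of
`Kerr.data M a M` and every MAXIMAL vacuum Cauchy development `𝒟` of `D`, there is a chart `Ψ` from the Kerr
star region `{r > M}` (background `B = (Kerr.region a M, g_{M,a}, t*, r)`, `ModelBackground`) into `𝒟`,
smooth and an open embedding on the slab `{0 < t* < T/κ + 1}`, continuous up to `{t* = 0}` where it IS the
data embedding (`Ψ(0, y) = ι y`: anchored — no boost/translation freedom), in which the `Cᵏ` sup-deviation
`Ψ^*g − g_{M,a}` (`Spacetime.deviationCk` for the background `⟨Kerr.region a M, Kerr.bilin M a, t*, r⟩`, written in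
place) on every slab `{t* = τ}`, `0 < τ ≤ T/κ` (`κ = Kerr.surfaceGravity M a`, written in place), is
`≤ C·χ^{−p}·√dist`. I.e. the solution stays
polynomially close to the INITIAL Kerr member for one unit of thermal time `t̂ = κ t* ≤ T` (the region
`{t* ≥ 0, r > M}` lies in `D⁺` of the slice: `t*` is a time function and `r` decreases to the future on
`r₋ < r < r₊`). WHY PLAUSIBLY TRUE: on the face collar this is a UNIT-time nonlinear Cauchy/characteristic
problem for the Einstein equations on the smooth family of S1 (local well-posedness with `κ`-free constants on
the explicit near-NHEK₁ face, red-shift S2 for the horizon-transversal derivatives; no Grönwall factor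
`e^{Ct*} = e^{C/κ}` because in `t̂` the time is `O(1)`); outside the collar the time `T/κ` is long but the
geometry is uniformly non-degenerate in `a` (far face) and only `κ`-polynomial BOUNDEDNESS (not decay) of the
linearisation is needed (DRSR-type, the `τ ≤ T/κ` part of clause (a) of `KappaExplicitWaveDecay`, at the
tensorial level) — with data `√dist ≤ √c·χ^{γ/2}` and `γ` large the nonlinear terms over time `T/κ` are
`O(dist·χ^{−q}·T/κ) ≪ √dist`; mode stability for all `|a| < M` (Whiting; `Kerr.Costa2019_realAxisModeStability_holds`
on the real axis) excludes growing modes, zero-damped modes decay at rate `≍ κ`, so `e^{−κ·T/κ} = e^{−T}`;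
the recoil/drift of the true final state relative to the anchored gauge is `≲ √dist·χ^{−p}·T/κ`, polynomial,
inside the bound (this is WHY the statement is finite-time: anchored closeness for all times is false). The
spherical analogue is a theorem (Angelopoulos–Kehle–Unger arXiv:2603.10378, Thms 1, 4: transient horizon
instability up to `v ~ κ⁻¹`, polynomial size, uniform basin). WHY IT MIGHT FAIL: a genuinely nonlinear
near-extremal transient amplification `≫ κ^{−N}` for every `N` within time `κ⁻¹` (echo/feedback,
Yang–Zimmerman–Lehner arXiv:1402.4859 — but that needs amplitude `≳ κ`, outside every basin `cχ^γ`, `γ ≥ 1`);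
or failure of sup-norm `Cᵏ` control near `i⁰` on the full slabs (then restate with truncated slabs
`truncDeviationCk` — a typing repair, not a kill). Linear-proxy falsifier (kit):
`sup_{t* ≤ T/κ} E[ψ_m](t*)/E_j[ψ_m](0)` on `a = M(1 − 10^{−j})` must be polynomial in `κ⁻¹`
(Gralla–Zimmerman–Zimmerman: `κ^{−1/2}…κ^{−1}`). Disproof §6 is respected automatically (`∃ γ, δ`; the
exterior-truncated lighter members need `η > Mχ/2`, outside every basin with `γ > 1`). Size XL. Leans on:
S1, S2, `VacuumCauchyDevelopment`, `ModelBackground`/`Spacetime.deviationCk` (KerrConvergence), `Kerr.data`,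
`InitialDataSet.dataWeightedSobolevEDist`; Klainerman–Szeftel/GKS local theory (arXiv:2104.11857,
arXiv:2205.14808), DHRT arXiv:2212.14093 §1.4.4 (Cauchy stability as a black box), AKU 2026. -/
theorem stub_thermalTimeStability :
    (∀ M : ℝ, 0 < M → ∀ X : ℝ, 0 < X →
      ∃ G : ℝ → ℝ → ℝ → Fin 4 → Fin 4 → ℝ,
        ContDiffOn ℝ ∞ (fun q : ℝ × ℝ × ℝ ↦ G q.1 q.2.1 q.2.2)
            (Icc (0 : ℝ) (1 / 2) ×ˢ Icc (-(1 / 2) : ℝ) X ×ˢ (univ : Set ℝ)) ∧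
        (∀ σ ∈ Ioc (0 : ℝ) (1 / 2), ∀ x ∈ Icc (-(1 / 2) : ℝ) X, ∀ θ φ : ℝ, ∀ α β : Fin 4,
          ∀ (a r : ℝ) (pt : E4) (e : Fin 4 → E4), a = M * √(1 - σ ^ 2) →
            r = Kerr.rPlus M a + x * (Kerr.rPlus M a - Kerr.rMinus M a) →
            pt = E4.ofTimeSpace 0 (Kerr.kerrStar a r θ φ) →
            e = ![(Kerr.surfaceGravity M a)⁻¹ • Kerr.hawkingVector M a pt,
                  (Kerr.rPlus M a - Kerr.rMinus M a) • E4.ofTimeSpace 0 (sphRadial θ φ),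
                  E4.ofTimeSpace 0 (r • sphPolar θ φ + (a * Real.cos θ) • sphAzimuth φ),
                  Kerr.axialVector pt] →
            G σ x θ α β = Kerr.bilin M a pt (e α) (e β)) ∧
        (∀ σ ∈ Icc (0 : ℝ) (1 / 2), ∀ θ : ℝ,
          G σ 0 θ 0 0 = 0 ∧
          G σ 0 θ 0 1 = 2 * (Kerr.rPlus M (M * √(1 - σ ^ 2)) ^ 2 + (M * √(1 - σ ^ 2)) ^ 2 * Real.cos θ ^ 2) ∧
          deriv (fun x : ℝ ↦ G σ x θ 0 0) 0 = -2 * G σ 0 θ 0 1) ∧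
        (∀ x ∈ Icc (-(1 / 2) : ℝ) X, ∀ θ : ℝ,
          G 0 x θ 0 0 = -4 * M ^ 2 * (1 + Real.cos θ ^ 2) * x * (1 + x) +
              16 * M ^ 2 * (1 - Real.cos θ ^ 2) * x ^ 2 / (1 + Real.cos θ ^ 2) ∧
          G 0 x θ 0 1 = 2 * M ^ 2 * (1 + Real.cos θ ^ 2) ∧ G 0 x θ 1 1 = 0 ∧
          G 0 x θ 2 2 = M ^ 2 * (1 + Real.cos θ ^ 2) ∧
          G 0 x θ 3 3 = 4 * M ^ 2 * (1 - Real.cos θ ^ 2) / (1 + Real.cos θ ^ 2) ∧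
          G 0 x θ 0 3 = 8 * M ^ 2 * (1 - Real.cos θ ^ 2) * x / (1 + Real.cos θ ^ 2) ∧
          G 0 x θ 0 2 = 0 ∧ G 0 x θ 1 2 = 0 ∧ G 0 x θ 1 3 = 0 ∧ G 0 x θ 2 3 = 0)) →
    (∀ M : ℝ, 0 < M → ∃ (N₁ : ℕ) (A θ₀ b : ℝ), 0 < θ₀ ∧ 0 < b ∧
      ∀ a : ℝ, Kerr.IsSubextremal M a → ∃ h₁ f₁ : ℝ,
        |h₁| + |f₁| ≤ A * (Kerr.surfaceGravity M a)⁻¹ ^ N₁ ∧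
        ∀ x : E4, |Kerr.radius a x - Kerr.rPlus M a| ≤ θ₀ * (Kerr.rPlus M a - Kerr.rMinus M a) →
          ∀ w : E4 → ℝ, DifferentiableAt ℝ w x →
            b * Kerr.surfaceGravity M a ^ N₁ *
                (Kerr.hawkingComp M a x (fun μ ↦ fderiv ℝ w x (E4.basisVector μ)) ^ 2 +
                  Kerr.frameIn a x (fun μ ↦ fderiv ℝ w x (E4.basisVector μ)) ^ 2 +
                  Kerr.frameAngSq a x ((fun μ ↦ fderiv ℝ w x (E4.basisVector μ)) +
                    Kerr.frameIn a x (fun μ ↦ fderiv ℝ w x (E4.basisVector μ)) • Kerr.dRadius a x)) ≤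
              KerrSchild.multiplierBulk (Kerr.inverseMetric M a) (Kerr.redShiftVector M a h₁ f₁) w x) →
    (∀ [Kerr.Facts] [Kerr.SliceFacts], ∀ T : ℝ, 0 < T → ∀ k : ℕ, ∃ (s : ℕ) (δ : ℝ) (γ p a₁ : ℝ), a₁ < 1 ∧
      ∀ (M : ℝ) (hM : 0 < M), ∃ c > (0 : ℝ), ∃ C : ℝ, ∀ a : ℝ, a₁ * M ≤ |a| → Kerr.IsSubextremal M a →
        ∀ (D : InitialDataSet 𝓘(ℝ, E3) (Kerr.slice a M)) [D.metric.HasLeviCivita],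
          D.IsVacuumConstraintSolution →
            InitialDataSet.dataWeightedSobolevEDist s δ D (Kerr.data M a M hM.le) <
                ENNReal.ofReal (c * (1 - (a / M) ^ 2) ^ γ) →
              ∀ 𝒟 : VacuumCauchyDevelopment D, 𝒟.IsMaximal →
                ∃ Ψ : Kerr.region a M → 𝒟.carrier,
                  ContMDiffOn 𝓘(ℝ, E4) (𝓡 4) ∞ Ψ
                    {x | 0 < x.1 0 ∧ x.1 0 < T / Kerr.surfaceGravity M a + 1} ∧
                  Topology.IsOpenEmbedding
                    ({x : Kerr.region a M | 0 < x.1 0 ∧ x.1 0 < T / Kerr.surfaceGravity M a + 1}.restrict Ψ) ∧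
                  ContinuousOn Ψ {x | 0 ≤ x.1 0 ∧ x.1 0 < T / Kerr.surfaceGravity M a + 1} ∧
                  (∀ y : Kerr.slice a M,
                    Ψ ⟨E4.ofTimeSpace 0 (y : E3), Kerr.mem_slice_iff_ofTimeSpace_mem_region.1 y.2⟩ =
                      𝒟.embed y) ∧
                  ∀ τ ∈ Ioc 0 (T / Kerr.surfaceGravity M a),
                    𝒟.toSpacetime.deviationCk
                        ⟨Kerr.region a M, Kerr.bilin M a, fun x ↦ x 0, Kerr.radius a⟩ Ψ k τ ≤
                      ENNReal.ofReal (C * (1 - (a / M) ^ 2) ^ (-p) *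
                        √(InitialDataSet.dataWeightedSobolevEDist s δ D (Kerr.data M a M hM.le)).toReal)) := by
  sorry

/-- **S4 · `stub_captureTransfer` — HARDEST, load-bearing: from thermal time on, the `κ`-explicit linear
floor captures the solution; modulation and far completeness on the resolved space.** From the anchored
thermal-time chart (conclusion of S3, stated verbatim) and the route's LINEAR FLOOR `KappaExplicitWaveDecay`
(crux stmt-FinalStateConjecture-10654, by name: `κ`-explicit uniform boundedness + integrated local energy
decay for scalar waves on the whole sub-extremal range — the registered proxy; the tensorial / gauge-fixed
upgrade (Teukolsky `s = ±2`, or the linearised operator `L_b` of Hintz arXiv:2606.28253) with the same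
`κ`-power law is PART OF THIS STUB'S BURDEN; the sibling skeleton `Lines/polynomial-closure.lean` registers
exactly that upgrade as `stub_kappaPolynomialTeukolskyLaw` — a one-antecedent reshape if it lands first)
conclude `∀ [Kerr.Facts] [Kerr.SliceFacts], ∃ (s δ k γ p a₁), a₁ < 1 ∧ CaptureWithoutSub s δ k γ p a₁` — the
crux body with the conjunct `Kerr.IsSubextremal M' a'` DELETED (landed `Negative.CaptureWithoutSub`; by
`near_iff_withoutSub` this target is EQUIVALENT to the crux, so S4 proves exactly the crux minus a logically
redundant clause, and the composition restores it). HOW (the card, sharpened by triage): run the nonlinear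
scheme (GKS arXiv:2205.14808 near-horizon red-shift/transport estimates, or Hintz's Nash–Moser, Thm. 13.1 /
Rem. 13.2 with the slice margin `m₀ = M ∈ (r₋, r₊)`) on the RESOLVED space: (i) COLLAR `x̂ ≤ X < 1/3` (inside
the face light surface of S1 (iii): `ê₀` timelike on `0 < x̂ < 1/3` even at the equator, so the `ê₀`-energy
+ S2 is coercive) in thermal time with `κ`-free constants — an a-priori estimate COUPLED to the far solution
through two-sided fluxes at `x̂ = X`, never a stand-alone IBVP (triage r1-1, r1-3 (b)); (ii) FAR FACE
`r − M ≳ cM`: the extremal-Kerr exterior minus a collar, uniformly non-degenerate for `a ∈ [a₁M, M]`, where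
mass/spin/centre-of-mass modulation and the AF end live with `a`-continuous constants; (iii) THROAT
`κM ≪ r − r₊ ≪ M` (`log(1/κM)` self-similar e-folds): handled in frequency space by the linear floor and its
sibling line `extremal-corner-blowup` (same blow-up on the radial ODE; superradiant turning zones are
barriers, not wells — triage r1-1 §B / r1-2 E8: flux is conserved across them, so ODE/Wronskian bookkeeping,
never products of local norms), transfer losses per e-fold compounding to `κ^{−O(1)}`; (iv) ONE face
modulation parameter, the temperature ratio `κ'/κ` (NHEK is non-dynamical: Amsel–Horowitz–Marolf–Roberts
arXiv:0906.2376, Dias–Reall–Santos arXiv:0906.2380), read off the conserved charges at `δ ≥ 1/2` (triage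
r1-2 R2) — its drift `|κ'/κ − 1| ≍ dist/χ` is the kinematic basin law `γ = 1 (+ matching loss)`, matching the
refuter's necessary exponent (ATTACK-10606 §6; Disproof §6); (v) far completeness of `𝓘⁺` (sojourn form,
`FarComplete`) from the far-region estimates. The powers of `κ` in basin (`γ`) and modulus (`p`) are read off
the blow-down: `t* = t̂/κ`, `∂_{t*} = κ∂_t̂ + ω₊∂_φ̂`, unscaled size `ε` ↦ face size `ε/κ²`. WHY IT MIGHT FAIL
(honest residual = the crux's): matching across the throat may feed back into the smallness (`γ = 1 + q`,
fine for `∃γ` unless `q = q(κ) → ∞`); the scalar floor may hold while its `s = ±2`/GCM analogue loses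
`exp(c/κ)` (gauge/constraint-damping thresholds `κ`-dependent; radial-point threshold regularity
`s > ½ + β|Im σ|/κ`: keep the contour at `Im σ ≥ −c₀κ`, triage r1-1); mode-wise amplification `κ^{−cm}` in
the uncharted corner `m → ∞`, `|ω − mω₊| ≪ |m|` (Disproof docstring; Gajic §1.4) would kill S4 and the crux
alike; [Hin26] is unrefereed (fallback: GKS architecture for `|a| ≪ M` does not reach `a₁M ≤ |a|`). Size XL.
Leans on: S3 (conclusion), `KappaExplicitWaveDecay` (by name), `Negative.FarComplete`/`CaptureWithoutSub`
(landed), `Spacetime.ConvergesToKerr`, `Kerr.Costa2019_realAxisModeStability_holds` (tree theorem, real axis),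
`TeukolskyWronskianBound` (named fact, all spins); Hintz arXiv:2606.28253 Rem. 1.4 / Thm. 13.1; GKS; DHRT
arXiv:2212.14093 §1.4.4; TdC arXiv:1910.02854 Prop. 6.3; Gralla–Zimmerman arXiv:1804.04753 §2.3; BHSS
arXiv:0907.3477 §4.4–4.5; AKU arXiv:2603.10378. -/
theorem stub_captureTransfer :
    (∀ [Kerr.Facts] [Kerr.SliceFacts], ∀ T : ℝ, 0 < T → ∀ k : ℕ, ∃ (s : ℕ) (δ : ℝ) (γ p a₁ : ℝ), a₁ < 1 ∧
      ∀ (M : ℝ) (hM : 0 < M), ∃ c > (0 : ℝ), ∃ C : ℝ, ∀ a : ℝ, a₁ * M ≤ |a| → Kerr.IsSubextremal M a →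
        ∀ (D : InitialDataSet 𝓘(ℝ, E3) (Kerr.slice a M)) [D.metric.HasLeviCivita],
          D.IsVacuumConstraintSolution →
            InitialDataSet.dataWeightedSobolevEDist s δ D (Kerr.data M a M hM.le) <
                ENNReal.ofReal (c * (1 - (a / M) ^ 2) ^ γ) →
              ∀ 𝒟 : VacuumCauchyDevelopment D, 𝒟.IsMaximal →
                ∃ Ψ : Kerr.region a M → 𝒟.carrier,
                  ContMDiffOn 𝓘(ℝ, E4) (𝓡 4) ∞ Ψ
                    {x | 0 < x.1 0 ∧ x.1 0 < T / Kerr.surfaceGravity M a + 1} ∧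
                  Topology.IsOpenEmbedding
                    ({x : Kerr.region a M | 0 < x.1 0 ∧ x.1 0 < T / Kerr.surfaceGravity M a + 1}.restrict Ψ) ∧
                  ContinuousOn Ψ {x | 0 ≤ x.1 0 ∧ x.1 0 < T / Kerr.surfaceGravity M a + 1} ∧
                  (∀ y : Kerr.slice a M,
                    Ψ ⟨E4.ofTimeSpace 0 (y : E3), Kerr.mem_slice_iff_ofTimeSpace_mem_region.1 y.2⟩ =
                      𝒟.embed y) ∧
                  ∀ τ ∈ Ioc 0 (T / Kerr.surfaceGravity M a),
                    𝒟.toSpacetime.deviationCk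
                        ⟨Kerr.region a M, Kerr.bilin M a, fun x ↦ x 0, Kerr.radius a⟩ Ψ k τ ≤
                      ENNReal.ofReal (C * (1 - (a / M) ^ 2) ^ (-p) *
                        √(InitialDataSet.dataWeightedSobolevEDist s δ D (Kerr.data M a M hM.le)).toReal)) →
    KappaExplicitWaveDecay →
    (∀ [Kerr.Facts] [Kerr.SliceFacts], ∃ (s : ℕ) (δ : ℝ) (k : ℕ) (γ p a₁ : ℝ),
      a₁ < 1 ∧ CaptureWithoutSub s δ k γ p a₁) := by
  sorry

/-! ## Names for the four statements (hypotheses of the composition)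

The skeleton audit admits as hypotheses of the concluding theorem only registered obligations or the declared
stubs BY NAME; `Statement.stub_x` is the statement of `stub_x` (`type_of%`) under the stub's own short name. -/

namespace Statement

/-- Statement of `stub_unitTemperatureFace`. -/
abbrev stub_unitTemperatureFace : Prop := type_of% UnitTemperatureFrontFace.stub_unitTemperatureFace
/-- Statement of `stub_faceRedShift`. -/
abbrev stub_faceRedShift : Prop := type_of% UnitTemperatureFrontFace.stub_faceRedShift
/-- Statement of `stub_thermalTimeStability` (S1 ⇒ S2 ⇒ anchored thermal-time chart). -/
abbrev stub_thermalTimeStability : Prop := type_of% UnitTemperatureFrontFace.stub_thermalTimeStability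
/-- Statement of `stub_captureTransfer` (thermal-time chart ⇒ linear floor ⇒ capture without the
sub-extremality conjunct, `CaptureWithoutSub` by name). -/
abbrev stub_captureTransfer : Prop := type_of% UnitTemperatureFrontFace.stub_captureTransfer

end Statement

/-! ## The composition (kernel-checked, sorry-free) -/

/-- **`NearExtremalKappaCapture_of`** — the four stub STATEMENTS and the route's linear floor
`KappaExplicitWaveDecay` (route item, by name) imply the crux, BY NAME. Plumbing: S3 consumes S1 and S2, S4
consumes S3's anchored thermal-time chart and the linear floor; the real step is the restoration of the
conjunct `Kerr.IsSubextremal M' a'`, which is the LANDED `Negative.near_iff_withoutSub` (p74448: raise the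
basin exponent to `max γ (2p+2)`, shrink the basin constant, read sub-extremality of `(M', a')` off the
modulus). The instance binders `∀ [Kerr.Facts] [Kerr.SliceFacts]` are kept un-instantiated (`@`). -/
theorem NearExtremalKappaCapture_of (h₁ : Statement.stub_unitTemperatureFace)
    (h₂ : Statement.stub_faceRedShift) (h₃ : Statement.stub_thermalTimeStability)
    (h₄ : Statement.stub_captureTransfer) (hK : KappaExplicitWaveDecay) :
    NearExtremalKappaCapture := by
  -- entry through the landed redundancy theorem; equivalently `rw [near_iff]` and close with
  -- `captureWith_of_withoutSub h (le_max_left _ _) (le_max_right _ _)` at `γ' = max γ (2p + 2)`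
  rw [near_iff_withoutSub]
  intro hF hS
  exact @h₄ (@h₃ h₁ h₂) hK hF hS

/-- The crux along this line MODULO the four registered stubs: granted the route's linear floor
`KappaExplicitWaveDecay` (route item stmt-FinalStateConjecture-10654), `NearExtremalKappaCapture` follows
from the sorried stubs — this theorem references every `stub_*`, so the skeleton audit's closure lists
exactly the sorries the crux still depends on along this line; the lead closes the crux by discharging them
(and the sibling crux). -/
theorem NearExtremalKappaCapture_of_linearFloor (hK : KappaExplicitWaveDecay) : NearExtremalKappaCapture :=
  NearExtremalKappaCapture_of stub_unitTemperatureFace stub_faceRedShift stub_thermalTimeStability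
    stub_captureTransfer hK

end Summit.FinalStateConjecture.FinalStateConjecture.Cruxes.NearExtremalKappaCapture.UnitTemperatureFrontFace
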